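import Literature.Claims.NS.ClayVariants
import Literature.Claims.NS.ClayPeriodicLerayHopfBridge
import Literature.Analysis.FluidPDE.LerayHopf
import Literature.Analysis.FunctionSpaces.FlatTorus
import HarnessLib

/-!
# Claim skeleton (D-0090 NS-CLAIMS, C13b): J. Kampen, «Some new consequences of the CKN-theory»,
# arXiv:1502.06699 v3 (2016)

Cell `ns-claims`, sub-row C13b of C13 `Kampen2014` (lead rulings 2026-08-26T20:22:24Z (2), 22:00:28Z (5)),
typist `ns-claims-typist-12` (lanes: refuter-7, ref-3, salvage-p6, writer-1). UNREFEREED CLAIM under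
adjudication — NOTHING in this file asserts a step: every `Step_k` / `Lemma21` / `ClaimedTheorem` is a
`Prop`; the `theorem`s are kernel compositions of the paper's own implications and one elementary inequality.
Text of record (PINNED by ns-claims-lit-1, `pub/ns-claims/sources/Kampen2015/LOCATORS.md` §0): arXiv
1502.06699 **v3** (18 May 2016, 29 pp., math.AP), bib `Kampen2015CKN`; print page = PDF page; `(n)` = printed
display number; TeX labels of `1502.06699v3_PowerCKN.tex` in brackets. Card `pub/ns-claims/claims/Kampen2015/
CARD.md` (PREDICTION §4 frozen 22:13:22Z, sha16 e48922c02da29f8f). Lineage: C13 = arXiv 1309.4824 v11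
(`Literature.Claims.NS.Kampen2014`); Cor 1.8 / §4 / Appendix 1 of THIS paper re-assert the C13 conclusion
CONDITIONAL on «local time contraction results … proved elsewhere» (p. 11) and are not typed here.

## Claimed statements (as printed)

Setting §1 pp. 1–3: the periodic problem on `𝕋ⁿ` with `L²` data, `ν > 0`; Hopf's global weak solution (2);
CKN partial regularity (3)–(5): the singular set `S` has vanishing one-dimensional (parabolic) Hausdorff
measure, `v ∈ L^{8/3}([0,T], L⁴(𝕋³))` (5); epochs of regularity (6)–(7), (10): `v ∈ C^∞(U_j × 𝕋ⁿ)` on an open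
dense union of intervals, every singular time being a right endpoint `t_s` of such an interval `(t₀, t_s)`.
Definition 1.1 p. 4: «singularity of order (λ, μ) from the left at (t_s, x_s)» = on a backward cone
`K = {t ∈ (t₁,t_s), |x − x_s| < t_s − t}` (11)/(17), `|f(t,x)| ≤ c/(|t − t_s|^μ |x − x_s|^λ)` and no smaller
exponents. **Theorem 1.2 p. 4** [thmsing1]: «For a given time horizon T > 0 let v_i, 1 ≤ i ≤ n be a weak
Leray-Hopf solution of the Navier Stokes equation, where v_i ∈ L²([0,T],H¹) for all 1 ≤ i ≤ n. Then after any
finite time this solution v_i … has no singularities of order (μ₀,λ₀) from the left for any 0 < λ₀, μ₀. In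
other words, the Leray-Hopf solution is left-continuous an the time interval (0,T] for arbitrary given T.
Moreover, the assumption can be weakened assuming that v_i ∈ L²([0,T],H^{1−ε}) for any ε > 0 …»; the sentence
before it (p. 4): «we shall show that there is a uniform upper bound (from the left) at each time section
{t_s} × 𝕋ⁿ. This implies that a Leray-Hopf solution has a left-continuous extension.» — `ClaimedTheorem`
(rendering below). **Theorem 1.7 p. 11** [thmsing2]: v and its spatial derivatives up to second order
«can be continuously extended to the Haussdorff set of possible singularities» after any finite time; §3 (86)
p. 16: `sup_{t ∈ [t₁,t_s]} ‖v(t,·)‖_{H²∩C²} ≤ C`. **Corollary 1.8 p. 11**: global existence and uniqueness for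
`H¹`-in-time-and-space solutions; «if a local time contraction results for the initial data, then global
existence and uniqueness hold for all time … The local contraction results were proved elsewhere.»

RENDERING. `n = 3`, torus `𝕋³ = UnitAddTorus (Fin 3)` with the tree's Leray–Hopf class
`Literature.Analysis.FluidPDE.Torus.IsLerayHopfOn T ν 0 u₀ u` (its field `memL2Sobolev` IS the hypothesis
«v ∈ L²([0,T],H¹)», automatic for Leray–Hopf solutions, as the paper notes); `ClaimedTheorem` := the p. 4
gloss of Thm 1.2 — for every `t_s ∈ (0,T]` the solution is essentially bounded on `(t₁, t_s) × 𝕋³` for some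
`t₁ < t_s` (a uniform upper bound from the left at each time section). Pointwise statements on cones are
made for a SMOOTH REPRESENTATIVE `w` of `u` on an epoch of regularity `(t₀, t_s) × 𝕋³` (`IsSmoothRepOn`,
(7) p. 2), read on the lift `x ↦ w t (Torus.proj x)` of `ℝ³`. TODO(general form): `n ≤ 3` generic, the
`H^{1−ε}` variants, Thm 1.7 / (86) (the `H² ∩ C²` version; same proof skeleton, §3 «higher order version»),
Cor 1.8 (conditional on the C13 cluster).

## Clay delta (reference `Literature.Claims.NS.ClayVariants`, axes Δ1–Δ8)

Nearest: (B) `ClayVariants.clayPeriodic.Regularity`. Δ1 `𝕋ⁿ`, `n ≤ 3` (Lemma 2.1) ⊇ `𝕋³` = · Δ3 `f ≡ 0` = ·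
Δ4 data `L²` (every Leray–Hopf solution): BROADER · Δ5 weak Leray–Hopf · Δ6 conclusion = eventual («after
any finite time») boundedness from the left / left-continuity — DIFFERENT IN FORM from (B)'s smoothness on
`[0,∞)`; the passage «Thm 1.2 for all Leray–Hopf solutions + smooth periodic datum ⇒ (B)» (local smooth
solution on `[0,t₀]`, weak–strong uniqueness, essential boundedness ⇒ Serrin regularity, gluing) is classical
but NOT printed — typed as `Step_bridgeB`, not proved here · Δ7 fixed `ν > 0` = · Δ8 n/a until (B) is
reached. No wrong-problem axis is expected to carry the verdict.

## Steps — ORDERED INDEX (TYPING-HYGIENE 11; the paper's order: §1 preliminaries used in §2, then §2)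

Step 0 = `Step_0` ((6)–(7), (10) pp. 2–3: epochs of regularity — before every time `t_s ∈ (0,T]` the solution
is smooth on some slab `(t₀,t_s) × 𝕋³`; classical, Leray 1934 — typist's flag: classical/cite; **REV 2: flag withdrawn —
see `Step_0Abs` (the printed inference p. 2 TeX l. 87 «if t_s ∈ ℝ₊ ∖ I … then there exists … U_j = (t₀,t_s) ⊂ I»
at the open-set grain, HYGIENE 13 companion; `Step_0` itself is of open strength at the NS grain)**) · Step 1 =
`Step_1` ((12)–(13) p. 3: «(5) implies v ∈ L^{8/3}([t₀,t_s],L⁴) … we have v ∈ C^∞(K) and for all (t,x) ∈ K: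
|v_i(t,x)| ≤ c/((t_s − t)^μ |x − x_s|^λ) for some … 0 ≤ μ < 3/8, 0 ≤ λ < 3/4» — no derivation printed; the
exponents are the integrability thresholds of `L^{8/3}_t`, `L⁴_x` read backwards — typist's flag: suspicious
(integrability does not give pointwise rates); abstract companion `Step_1Abs`) · Step 2 = `Step_2` ((14)–(15)
p. 3 = (55)–(56) p. 12: the same for `∇v` from `L²_tH¹`: `0 ≤ μ₀ < 1/2`, `0 ≤ λ₀ < 3/2`) · Step 3 = `Step_3`
((61) ⇒ (62) p. 13, inside the proof of Lemma 2.1: from `Σ_β |β|² v_β(t)² < ∞` FOR EACH `t ∈ [t₁,t_s]` the print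
takes `sup_{t ∈ [t₁,t_s]} c*(t) =: c < ∞` — pointwise finiteness ⇒ finite supremum; abstract grain) · Step 4 =
`Step_4` ((62)–(63) p. 13: the convolution bound by `ab ≤ (a² + b²)/2`, uniformly in `α` — TRUE, PROVED
`step_4_holds` at the finitary grain) · Step 5 = `Step_5` ((64) ⇒ «Hence for n ≤ 3 we have p,i(t,·) ∈ L²»
p. 13: square-summability over `ℤ³ ∖ {0}` of the printed mode bound `|p,iα| ≤ n²c|2πα_i|/Σ_i 4π²α_i²` — the
print's reason «the factor α_i in the numerator occurs only on one dimension … the remaining n − 1 dimensional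
sum is also finite for n ≤ 3» — typist's flag: suspicious (`Σ_{α ∈ ℤ³∖0} α_i²/|α|⁴ = (1/3)Σ 1/|α|²` diverges);
this is the LAST inference of the proof of `Lemma21` ((54) p. 12, typed at the mode grain of its own proof))
· Step 6 = `Step_6` ((65) p. 13: from `p,i(t,·) ∈ L²` and smoothness off the tip to the pointwise rate
`|p,i| ≤ c/((t_s−t)^{δ₁}|x − x_s|^{3/2−ε})` — spatial abstract grain; suspicious) · Step 7 = `Step_7` ((53) p. 12
+ (67)–(85) pp. 14–16: the transfer — the four convolution terms of the representation of `w` on the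
cylinder are bounded using Steps 1–2, Lemma 2.1/(65), (72)–(75), the boundary term (78)–(85) with (81)
(«According to Hopf's result v ∈ L^∞([t₁,t_s],L²) such that |v|_{S_K}(t,x)| ≤ c/|x − x_s|^λ a.s. for some
0 ≤ λ < 1.5» — the Step-1 pattern again); conclusion `|v_i(t_s,x_s)| ≤ c′` uniformly («the upper bounds can
be constructed independently of x_s», p. 16) — typed at the solution level with Lemma 2.1 folded in: cone
bounds for a smooth representative ⇒ bounded from the left; load-bearing) · Bridge = `Step_bridgeB`
(unprinted classical passage to Clay (B)).

## COMPOSITION — proved as `claim_of_steps`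

`claim_of_steps : Step_0 → Step_1 → Step_2 → Step_7 → ClaimedTheorem` — PROVED (pure logic: epoch of
regularity, cone bounds, transfer). Steps 3–6 and `Lemma21` are the printed proof of the pressure input that
Step 7 consumes (Lemma 2.1 (54) ⇐ (58)–(64); (65)); they are typed separately at the grain where the print
argues (HYGIENE 13/F15) and are not hypotheses of `claim_of_steps` (Step 7 folds Lemma 2.1 in). NOT derivable
and not bridged: `ClaimedTheorem → clayPeriodic.Regularity` (= `Step_bridgeB`).

REV 2 (2026-08-27, ns-claims-typist-12 g4; ADDITIVE — one new `def Step_0Abs`, docstring sentences; no decl body,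
name or type of rev 1 touched; importers `Theorems/SoloRefuteKampen2015*.lean` unaffected). Rev 1 flagged
`Step_0` «classical (Leray 1934 structure theorem)». Re-reading p. 1 (i)–(ii) and p. 2 (6) against the sentence
p. 2 TeX l. 87 («Next if t_s ∈ ℝ₊ ∖ I is a time of a time slice {t_s} × 𝕋ⁿ related to a possible singularity, then
there exists an index j ∈ J and an open interval U_j = (t₀, t_s) ⊂ I») and p. 3 TeX l. 111 («Hence possible
singularities at (t_s, x_s) for positive time t_s > 0 are at the larger endpoint of such an open time interval (as is
well-known)»): what (i)–(ii) (Leray–Scheffer–CKN; tree `Literature.Analysis.FluidPDE.scheffer_singular_times`,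
`Literature.Barriers.NavierStokesRegularity.SingularSetDimensionBound`) print is that the regular times form an
open dense set of full measure whose complement has zero ½-dimensional Hausdorff measure — this does not make every
`t_s ∉ I` the right endpoint of a component of `I` (components may accumulate at `t_s` from the left). The
inference is therefore typed at the grain the sentence uses it, as `Step_0Abs` (a rule about open dense
full-measure subsets of `(0,∞)`); `Step_0` is its instance at the regular set and is, at the NS grain, of OPEN
strength (it follows from regularity of `H¹` slices plus weak–strong uniqueness, not from (i)–(ii)). `Step_0Abs` is
not a hypothesis of `claim_of_steps` (the kernel composition consumes the instance `Step_0`, first binder); it is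
the HYGIENE-13 companion of that binder, as `Step_1Abs` is of `Step_1`. Nothing asserted; keying is the chair's.

Design notes. No notation, no instance; `abbrev E3/T3` are plain abbreviations. Cone statements use the
junk-free multiplied form `‖f‖ · ((t_s − t)^μ · ‖x − x_s‖^λ) ≤ c` (at `x = x_s` the printed right side
`c/0` is vacuous and so is ours). Fourier modes are real families `(Fin 3 → ℤ) → (Fin 3 → ℝ)`; the factor
`i` and complex conjugation of (57)–(58) play no role in the summability inferences typed. `∀ᵐ` renders
«a.s.»/a.e. for the Leray–Hopf class (defined up to null sets).

WHAT THIS IS NOT: not a claim about NS regularity or blow-up; not a claim about any author beyond the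
typed locator.
-/

noncomputable section

open Set Function MeasureTheory Metric Filter Finset
open scoped ENNReal ContDiff Topology BigOperators
open Literature.Analysis.FunctionSpaces Literature.Analysis.FluidPDE

namespace Literature.Claims.NS.Kampen2015

/-- `ℝ³`, the paper's whole space / lift of the torus (§1 p. 1). [cite: Kampen2015CKN, §1 p. 1] -/
abbrev E3 := EuclideanSpace ℝ (Fin 3)
/-- `𝕋³ = (ℝ/ℤ)³`, the periodic domain of Hopf's theorem (§1 p. 1, «L⁴(𝕋³)» in (5)). [cite: Kampen2015CKN, §1 pp. 1–2] -/
abbrev T3 := UnitAddTorus (Fin 3)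

/-! ### Vocabulary -/

/-- «A uniform upper bound (from the left) at the time section {t_s} × 𝕋ⁿ» (p. 4): `u` is essentially bounded
on `(t₁, t_s) × 𝕋³` for some `t₁ < t_s`. [cite: Kampen2015CKN, p. 4 (sentence before Thm 1.2); Thm 1.2 p. 4] -/
def BoundedFromLeft (u : ℝ → T3 → E3) (ts : ℝ) : Prop :=
  ∃ t₁ : ℝ, t₁ < ts ∧ ∃ C : ℝ, ∀ᵐ t ∂(volume.restrict (Ioo t₁ ts)), ∀ᵐ x : T3, ‖u t x‖ ≤ C

/-- The backward cone (11)/(17) p. 3 below `(t_s, x_s)`, opened at time `t₀`: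
`{(t,x) : t₀ < t < t_s, |x − x_s| < t_s − t}` (read on the lift `ℝ³` of the torus).
[cite: Kampen2015CKN, (11) (16) (17) p. 3] -/
def cone (t₀ ts : ℝ) (xs : E3) : Set (ℝ × E3) :=
  {q | t₀ < q.1 ∧ q.1 < ts ∧ ‖q.2 - xs‖ < ts - q.1}

/-- `w` is a SMOOTH REPRESENTATIVE of `u` on the slab `(t₀, t_s) × 𝕋³` ((7) p. 2 «v_i ∈ C^∞(U_j × 𝕋ⁿ)»): the
lift `(t, x) ↦ w t (proj x)` is `C^∞` on `(t₀,t_s) × ℝ³` and `u t = w t` a.e. for every `t ∈ (t₀, t_s)`.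
[cite: Kampen2015CKN, (6)–(7) p. 2, (10) p. 3] -/
def IsSmoothRepOn (u w : ℝ → T3 → E3) (t₀ ts : ℝ) : Prop :=
  ContDiffOn ℝ ∞ (fun q : ℝ × E3 => w q.1 (Torus.proj q.2)) (Ioo t₀ ts ×ˢ univ) ∧
    ∀ t ∈ Ioo t₀ ts, u t =ᵐ[volume] w t

/-- The cone bound (12)–(13) p. 3 for `v` below `(t_s, x_s)`, for a smooth representative `w`, in the
junk-free multiplied form with the printed exponent range (`n = 3`). [cite: Kampen2015CKN, (12)–(13) p. 3] -/
def ConeBoundV (w : ℝ → T3 → E3) (t₀ ts : ℝ) (xs : E3) : Prop :=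
  ∃ c μ lam : ℝ, 0 ≤ μ ∧ μ < 3 / 8 ∧ 0 ≤ lam ∧ lam < 3 / 4 ∧
    ∀ t : ℝ, ∀ x : E3, (t, x) ∈ cone t₀ ts xs →
      ‖w t (Torus.proj x)‖ * ((ts - t) ^ μ * ‖x - xs‖ ^ lam) ≤ c

/-- The cone bound (14)–(15) p. 3 = (55)–(56) p. 12 for `∇v` below `(t_s, x_s)` (gradient of the lift), with the
printed exponent range of (56). [cite: Kampen2015CKN, (14)–(15) p. 3, (55)–(56) p. 12] -/
def ConeBoundGrad (w : ℝ → T3 → E3) (t₀ ts : ℝ) (xs : E3) : Prop :=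
  ∃ c μ₀ lam₀ : ℝ, 0 ≤ μ₀ ∧ μ₀ < 1 / 2 ∧ 0 ≤ lam₀ ∧ lam₀ < 3 / 2 ∧
    ∀ t : ℝ, ∀ x : E3, (t, x) ∈ cone t₀ ts xs →
      ‖fderiv ℝ (fun y : E3 => w t (Torus.proj y)) x‖ * ((ts - t) ^ μ₀ * ‖x - xs‖ ^ lam₀) ≤ c

/-- Both cone bounds (12) and (14) below `(t_s, x_s)`. [cite: Kampen2015CKN, (12)–(15) p. 3] -/
def ConeBounds (w : ℝ → T3 → E3) (t₀ ts : ℝ) (xs : E3) : Prop :=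
  ConeBoundV w t₀ ts xs ∧ ConeBoundGrad w t₀ ts xs

/-! ### The claimed statement -/

/-- **The claimed theorem (Thm 1.2 p. 4 with the p. 4 gloss), `n = 3`**: for every `ν > 0`, `T > 0`, every
Leray–Hopf weak solution `u` on `𝕋³ × [0,T)` with `L²` datum `u₀` (unforced) — «where v_i ∈ L²([0,T],H¹)» is
the field `memL2Sobolev` of the class — and every time `t_s ∈ (0, T]`: `u` is essentially bounded on
`(t₁, t_s) × 𝕋³` for some `t₁ < t_s` («no singularities of order (μ₀,λ₀) from the left for any 0 < λ₀, μ₀ …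
uniform upper bound (from the left) at each time section … left-continuous extension»). RENDERING: the
uniform-bound gloss; the Def-1.1 wording per cone is implied. TODO(general form): Thm 1.7 / (86) (`H² ∩ C²`
bounds), `H^{1−ε}` hypothesis variants, `n ≤ 3`. [cite: Kampen2015CKN, Thm 1.2 p. 4; p. 4] -/
def ClaimedTheorem : Prop :=
  ∀ ν : ℝ, 0 < ν → ∀ T : ℝ, 0 < T → ∀ (u₀ : T3 → E3) (u : ℝ → T3 → E3),
    Torus.IsLerayHopfOn T ν 0 u₀ u → ∀ ts ∈ Ioc 0 T, BoundedFromLeft u ts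

/-! ### The steps -/

/-- **Step 0 — epochs of regularity, (6)–(7) p. 2 and (10) p. 3** (quoted from Leray/CKN: «According to [2]
we know v_i ∈ C^∞(U_j × 𝕋ⁿ) … possible singularities at (t_s, x_s) for positive time t_s > 0 are at the larger
endpoint of such an open time interval (as is well-known)»): before every time `t_s ∈ (0,T]` there is a slab
`(t₀, t_s) × 𝕋³` on which `u` has a smooth representative. Typist's flag: classical (Leray 1934 structure
theorem), cite. [cite: Kampen2015CKN, (6)–(7) p. 2, (10) p. 3] -/
def Step_0 : Prop :=
  ∀ ν : ℝ, 0 < ν → ∀ T : ℝ, 0 < T → ∀ (u₀ : T3 → E3) (u : ℝ → T3 → E3),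
    Torus.IsLerayHopfOn T ν 0 u₀ u → ∀ ts ∈ Ioc 0 T,
      ∃ t₀ ∈ Ico 0 ts, ∃ w : ℝ → T3 → E3, IsSmoothRepOn u w t₀ ts

/-- **Step 0, abstract companion (TYPING-HYGIENE 13; rev 2, additive)** — the printed inference p. 2 TeX l. 87,
drawn from (i) p. 1 TeX l. 64 («there exists an open dense subset I ⊂ (0,∞) such that m_L(ℝ₊ ∖ I) = 0 … and such
that v_i ∈ C^∞(I × 𝕋ⁿ)») and (6) p. 2 («I = ∪_{j∈J} U_j, where J is an index set and U_j ⊂ ℝ₊ are open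
intervals»): «Next if t_s ∈ ℝ₊ ∖ I is a time of a time slice {t_s} × 𝕋ⁿ related to a possible singularity, then
there exists an index j ∈ J and an open interval U_j = (t₀, t_s) ⊂ I», restated p. 3 TeX l. 111 after (10)
(«Hence possible singularities at (t_s, x_s) for positive time t_s > 0 are at the larger endpoint of such an open
time interval (as is well-known)») — typed as the rule about subsets of the time axis that the sentence uses:
for every open `I ⊆ (0,∞)` that is dense in `(0,∞)` and of full Lebesgue measure there ((i)), whose excluded times
`(0,∞) ∖ I` moreover have zero one-dimensional Hausdorff measure (the time-axis content of (ii) p. 2 TeX l. 69–75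
«S … has vanishing one dimensional Hausdorff measure» — every printed property of `I`, HYGIENE 13 strongest
reading, chair 06:22:18Z; on `ℝ` it coincides with the Lebesgue clause), every `t_s ∈ (0,∞) ∖ I`
is the right endpoint of an open interval `(t₀, t_s) ⊆ I` (equivalently of a component `U_j` of `I`: the
component containing `(t₀, t_s)` cannot contain `t_s ∉ I`). `Step_0` is the instance `I` = regular times of the
Leray–Hopf solution. Typist's flag (rev 2): suspicious at this grain (left-accumulating components are compatible
with (i)–(ii)); at the NS grain (`Step_0`) open-strength, not classical — rev 1's flag is withdrawn (module
docstring, REV 2). Nothing asserted. (Rev 3, same day, in place while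
nothing imports the decl: the `μH[1]` clause added. Rev 4 added a cited-not-printed `μH[1/2]` clause (Leray–Scheffer,
[2]/[3]); rev 5 REMOVED it again on the referee of record's PRE-READ-BACK of rev 3 — «correctly left out as
unprinted … would not change anything» — so that the hypotheses are exactly the PRINTED properties of `I`
(HYGIENE 13) and the adopted kit of record 19b2de5d5d2d8de7 elaborates; the countable witness survives the
½-clause anyway.) [cite: Kampen2015CKN, (i) p. 1 (TeX l. 64); (ii) p. 2 (TeX l. 69–75); (6) and TeX l. 87 p. 2; TeX l. 111 p. 3] -/
def Step_0Abs : Prop :=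
  ∀ I : Set ℝ, IsOpen I → I ⊆ Set.Ioi (0 : ℝ) → Set.Ioi (0 : ℝ) ⊆ closure I →
    volume (Set.Ioi (0 : ℝ) \ I) = 0 → μH[1] (Set.Ioi (0 : ℝ) \ I) = 0 →
    ∀ ts ∈ Set.Ioi (0 : ℝ) \ I, ∃ t₀ : ℝ, t₀ < ts ∧ Set.Ioo t₀ ts ⊆ I

/-- **Step 1 — (12)–(13) p. 3, the cone bound for `v`**: «(5) implies v_i ∈ L^{8/3}([t₀,t_s],L⁴(𝕋³)) … For this
j and for all 1 ≤ i ≤ n we have v_i ∈ C^∞(K^{(t_s,x_s)}_j) and for all (t,x) ∈ K^{(t_s,x_s)}_j: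
|v_i(t,x)| ≤ c/((t_s − t)^μ |x − x_s|^λ) (12) for some finite constant c ∈ ℝ₊ and for some parameters μ, λ which
satisfy (case n = 3) 0 ≤ μ < 3/8, 0 ≤ λ < 3/4 (13)». No derivation is printed; `3/8` and `3/4` are the
thresholds below which `(t_s − t)^{−μ} ∈ L^{8/3}` and `|x − x_s|^{−λ} ∈ L⁴(ℝ³)`. TYPED for a smooth
representative of a Leray–Hopf solution on an epoch of regularity, together with its companion (14) as
`ConeBounds`. Typist's flag: suspicious (integrability ⇏ pointwise rate; abstract companion `Step_1Abs`).
[cite: Kampen2015CKN, (12)–(13) p. 3] -/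
def Step_1 : Prop :=
  ∀ ν : ℝ, 0 < ν → ∀ T : ℝ, 0 < T → ∀ (u₀ : T3 → E3) (u : ℝ → T3 → E3),
    Torus.IsLerayHopfOn T ν 0 u₀ u → ∀ ts ∈ Ioc 0 T, ∀ t₀ ∈ Ico 0 ts, ∀ w : ℝ → T3 → E3,
      IsSmoothRepOn u w t₀ ts → ∀ xs : E3, ConeBoundV w t₀ ts xs

/-- **Step 1, abstract companion (TYPING-HYGIENE 13)** — the inference behind (12) as a rule about
functions: a field on `(t₀,t_s) × 𝕋³` whose lift is smooth and which lies in `L^{8/3}((t₀,t_s), L⁴(𝕋³))`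
obeys the cone bound (12) with some `μ < 3/8`, `λ < 3/4`. (Kill route, for the record: a periodised bump of
height `r(t)^{−3/4}` and width `r(t) = exp(−1/(t_s − t))` centred at `x_s` has constant `L⁴` norm and violates
every such bound along `|x − x_s| = r(t)/2`.) [cite: Kampen2015CKN, (5) (8) p. 2, (12)–(13) p. 3] -/
def Step_1Abs : Prop :=
  ∀ (t₀ ts : ℝ) (xs : E3) (w : ℝ → T3 → E3), t₀ < ts →
    ContDiffOn ℝ ∞ (fun q : ℝ × E3 => w q.1 (Torus.proj q.2)) (Ioo t₀ ts ×ˢ univ) →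
    (∫⁻ t in Ioo t₀ ts, (∫⁻ y : T3, ‖w t y‖ₑ ^ (4 : ℝ)) ^ ((2 : ℝ) / 3)) < ⊤ →
      ∃ c μ lam : ℝ, 0 ≤ μ ∧ μ < 3 / 8 ∧ 0 ≤ lam ∧ lam < 3 / 4 ∧
        ∀ t : ℝ, ∀ x : E3, (t, x) ∈ cone t₀ ts xs →
          ‖w t (Torus.proj x)‖ * ((ts - t) ^ μ * ‖x - xs‖ ^ lam) ≤ c

/-- **Step 2 — (14)–(15) p. 3 = (55)–(56) p. 12, the cone bound for `∇v`**: «Concerning first order spatial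
derivatives we have for all 1 ≤ i ≤ n v_i ∈ L²([0,T],H^{1−ε}) …, hence for all (t,x) ∈ K̄: |v_{i,k}(t,x)| ≤
c/((t_s − t)^{μ₀}|x − x_s|^{λ₀}) (14) … 0 ≤ μ₀ < 1/2, 0 ≤ λ₀ < 3/2 + ε (15)»; in §2: «For a Hopf-Leray solution
v_i ∈ L²([t₁,t_s],H¹) we have for all (t,x) ∈ K: (55) … 0 ≤ δ₀ < 1/2, 0 ≤ λ₀ < 3/2 (56)». TYPED in the (55)–(56)
form for a smooth representative. Typist's flag: suspicious (same pattern as Step 1).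
[cite: Kampen2015CKN, (14)–(15) p. 3, (55)–(56) p. 12] -/
def Step_2 : Prop :=
  ∀ ν : ℝ, 0 < ν → ∀ T : ℝ, 0 < T → ∀ (u₀ : T3 → E3) (u : ℝ → T3 → E3),
    Torus.IsLerayHopfOn T ν 0 u₀ u → ∀ ts ∈ Ioc 0 T, ∀ t₀ ∈ Ico 0 ts, ∀ w : ℝ → T3 → E3,
      IsSmoothRepOn u w t₀ ts → ∀ xs : E3, ConeBoundGrad w t₀ ts xs

/-- **Step 3 — (61) ⇒ (62) p. 13 (proof of Lemma 2.1), the supremum over `t`**: «Since v_i(t,·) ∈ H¹ … we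
have Σ_{β∈ℤⁿ} |β|²(v_{iβ}(t))² < ∞ (61). Hence, Σ_γ 4π²γ_j(α_k − γ_k)v_{jγ}v_{k(α−γ)} ≤ sup_{t∈[t₁,t_s]} c*(t(τ))
=: c < ∞ (62), where … c*(t(τ)) := Σ_γ v²_{jγ}(τ) (63)». The hypothesis of Lemma 2.1 is «for all
t ∈ [t₁, t_s] … v_i(t,·) ∈ H¹» — finiteness of `c*(t)` for EACH `t`; the display asserts a finite SUPREMUM over
`[t₁,t_s]` (the «global constants» of the lemma's statement, p. 12). TYPED at the abstract grain over the
family `N = c* : ℝ → ℝ`: pointwise finite (here: real-valued, nonnegative) on `[t₁,t_s]` ⇒ bounded above on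
`[t₁,t_s]`. Typist's flag: suspicious (no uniformity is available from `L²_tH¹`). [cite: Kampen2015CKN, (61)–(63) p. 13; Lemma 2.1 p. 12] -/
def Step_3 : Prop :=
  ∀ t₁ ts : ℝ, t₁ < ts → ∀ N : ℝ → ℝ, (∀ t ∈ Icc t₁ ts, 0 ≤ N t) →
    ∃ c : ℝ, ∀ t ∈ Icc t₁ ts, N t ≤ c

/-- **Step 4 — (62)–(63) p. 13, the convolution bound by `ab ≤ (a² + b²)/2`, uniformly in `α`** (finitary
grain): for real mode families `a = v_j`, `b = v_k`, every `α` and every finite set of modes,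
`|Σ_γ γ_j(α_k − γ_k) a_γ b_{α−γ}| ≤ ½(Σ_γ γ_j² a_γ² + Σ_γ (α_k − γ_k)² b²_{α−γ})` — each sum bounded by an `H¹`
seminorm. TRUE; PROVED (`step_4_holds`). [cite: Kampen2015CKN, (62)–(63) p. 13] -/
def Step_4 : Prop :=
  ∀ (a b : (Fin 3 → ℤ) → ℝ) (j k : Fin 3) (α : Fin 3 → ℤ) (s : Finset (Fin 3 → ℤ)),
    |∑ γ ∈ s, (γ j : ℝ) * ((α k : ℝ) - (γ k : ℝ)) * a γ * b (α - γ)| ≤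
      (1 / 2) * (∑ γ ∈ s, ((γ j : ℝ)) ^ 2 * (a γ) ^ 2 +
        ∑ γ ∈ s, ((α k : ℝ) - (γ k : ℝ)) ^ 2 * (b (α - γ)) ^ 2)

/-- The printed mode bound (64) p. 13 for `∇p`, `n = 3`, component `i = 1` (index `0`):
`|p,iα| ≤ |2πiα_i| 1_{α≠0} n² c / Σ_i 4π²α_i²`. [cite: Kampen2015CKN, (64) p. 13] -/
def pModeBound (c : ℝ) (α : Fin 3 → ℤ) : ℝ :=
  if α = 0 then 0
  else (3 : ℝ) ^ 2 * c * |2 * Real.pi * (α 0 : ℝ)| / (∑ i : Fin 3, 4 * Real.pi ^ 2 * ((α i : ℝ)) ^ 2)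

/-- **Step 5 — (64) ⇒ «Hence for n ≤ 3 we have p,i(t,·) ∈ L²» p. 13**: «For given t ∈ [t₁,t_s] the square
|p,iα(t)|² has an integrable upper bound, where we note that the factor α_i in the numerator occurs only on
one dimension. Hence for n ≤ 3 we have p,i(t,·) ∈ L²» (and p. 13 bottom: «the factor Σ_{α_i∈ℤ}(α_i/α_i²)² =
Σ 1/α_i² … is finite and the remaining n − 1 dimensional sum is also finite for n ≤ 3 (comparison with
integral upper bounds)»). TYPED: the square of the printed bound (64) is summable over `α ∈ ℤ³` (Parseval
grain; every `c > 0`). The last inference of the printed proof of Lemma 2.1. Typist's flag: suspicious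
(`Σ_{α≠0} α_1²/|α|⁴ = (1/3) Σ_{α≠0} |α|^{−2}` diverges on `ℤ³`). [cite: Kampen2015CKN, (64) p. 13] -/
def Step_5 : Prop :=
  ∀ c : ℝ, 0 < c → Summable (fun α : Fin 3 → ℤ => pModeBound c α ^ 2)

/-- `(v_β)` are the (real) Fourier modes of an `H¹(𝕋³)` field: `Σ_β |β|² v_{iβ}² < ∞` for each component
((59)–(61) p. 13). [cite: Kampen2015CKN, (59)–(61) p. 13] -/
def H1Modes (vhat : (Fin 3 → ℤ) → (Fin 3 → ℝ)) : Prop :=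
  ∀ i : Fin 3, Summable (fun β : Fin 3 → ℤ => (∑ l : Fin 3, ((β l : ℝ)) ^ 2) * (vhat β i) ^ 2)

/-- The modes of `∂_i p` from (58) p. 13 (`n = 3`; real families, the factor `i` dropped):
`p,iα = 2πα_i 1_{α≠0} Σ_{j,k} Σ_γ 4π² γ_j(α_k − γ_k) v_{jγ} v_{k(α−γ)} / Σ_l 4π²α_l²`.
[cite: Kampen2015CKN, (58) p. 13] -/
def pGradMode (vhat : (Fin 3 → ℤ) → (Fin 3 → ℝ)) (i : Fin 3) (α : Fin 3 → ℤ) : ℝ :=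
  if α = 0 then 0
  else 2 * Real.pi * (α i : ℝ) *
      (∑ j : Fin 3, ∑ k : Fin 3, ∑' γ : Fin 3 → ℤ,
          4 * Real.pi ^ 2 * (γ j : ℝ) * ((α k : ℝ) - (γ k : ℝ)) * vhat γ j * vhat (α - γ) k) /
        (∑ l : Fin 3, 4 * Real.pi ^ 2 * ((α l : ℝ)) ^ 2)

/-- **Lemma 2.1 (54) p. 12 at the grain of its own proof (Fourier modes, fixed time, `n = 3`)**: «Assume that
n ≤ 3 and that for all t ∈ [t₁,t_s] a Leray-Hopf solution satisfies v_i(t,·) ∈ H¹. Then p,i ∈ L² (54). …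
Here we note that the upper bound constants used are global». TYPED: `H¹` modes ⇒ the (58)-modes of `∂_i p`
are square-summable (Parseval). Printed proof = Steps 3, 4, 5; the «global constants» clause = Step 3.
Typist's flag: suspicious (`H¹(𝕋³) · ∇H¹(𝕋³) ⊂ L^{3/2}`, not `L²`). [cite: Kampen2015CKN, Lemma 2.1 (54) p. 12, (57)–(64) p. 13] -/
def Lemma21 : Prop :=
  ∀ vhat : (Fin 3 → ℤ) → (Fin 3 → ℝ), H1Modes vhat →
    ∀ i : Fin 3, Summable (fun α : Fin 3 → ℤ => pGradMode vhat i α ^ 2)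

/-- **Step 6 — (65) p. 13**: «Hence, since (t_s, x_s) is the only singular point of p,i on the cone … we have
the spatial upper bound for all (t,x) ∈ K: |p,i(t,x)| ≤ c/((t_s − t)^{δ₁}|x_s − x|^{3/2−ε}) (65), where
δ₁ ∈ (0,1)». TYPED at the spatial abstract grain (fixed time): an `L²` function on the unit ball of `ℝ³` that is
smooth away from the centre obeys `|f(x)| ≤ c/|x − x_s|^{3/2−ε}` for some `ε > 0`. Typist's flag: suspicious
(`|x|^{−3/2}/log(e/|x|)` is `L²` near `0`). [cite: Kampen2015CKN, (65) p. 13] -/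
def Step_6 : Prop :=
  ∀ (f : E3 → ℝ) (xs : E3), ContDiffOn ℝ ∞ f {x | x ≠ xs} →
    MemLp f 2 (volume.restrict (ball xs 1)) →
      ∃ ε c : ℝ, 0 < ε ∧ ∀ x ∈ ball xs 1, |f x| * ‖x - xs‖ ^ ((3 : ℝ) / 2 - ε) ≤ c

/-- **Step 7 — the transfer, (53) p. 12 with (67)–(85) pp. 14–16**: «As a consequence of (37) we have
|v_i(t_s,x_s)| ≤ sup_{τ↑∞} |w_i(τ, z^τ_s)| ≤ [initial term + Burgers term + Leray projection term + boundary
term] (53)»; each term is bounded: (74) (Leray projection, using Lemma 2.1 via (65)/(70)–(71) and the kernel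
bounds (72)–(75)), (76) (Burgers), (77) (initial), (78)–(85) (boundary, using (81) «According to Hopf's result
… |v_i|_{S_K}(t,x)| ≤ c/|x − x_s|^λ a.s. for some 0 ≤ λ < 1.5»); p. 16: «the upper bounds can be constructed
independently of x_s». TYPED at the solution level with Lemma 2.1 folded in: for a Leray–Hopf solution with
a smooth representative on `(t₀,t_s) × 𝕋³` obeying the cone bounds (12), (14) below every `x_s`, the solution
is bounded from the left at `t_s`. Load-bearing. Typist's flag: suspicious. [cite: Kampen2015CKN, (53) p. 12, (67)–(85) pp. 14–16] -/
def Step_7 : Prop :=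
  ∀ ν : ℝ, 0 < ν → ∀ T : ℝ, 0 < T → ∀ (u₀ : T3 → E3) (u : ℝ → T3 → E3),
    Torus.IsLerayHopfOn T ν 0 u₀ u → ∀ ts ∈ Ioc 0 T, ∀ t₀ ∈ Ico 0 ts, ∀ w : ℝ → T3 → E3,
      IsSmoothRepOn u w t₀ ts → (∀ xs : E3, ConeBounds w t₀ ts xs) → BoundedFromLeft u ts

/-- **Bridge (unprinted) — Thm 1.2 for all Leray–Hopf solutions ⇒ Clay (B)** `ClayVariants.clayPeriodic.
Regularity`: for a smooth periodic divergence-free datum, a local smooth solution on `[0,t₀]`, weak–strong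
uniqueness against Hopf's weak solution, essential boundedness from the left before every `t_s` ⇒ no singular
time (Serrin `L^∞_tL^∞_x`), gluing over `T → ∞`. Classical ingredients, not printed in the paper (p. 4: «We
shall combine this with local time regularity arguments in order to obtain global regularity results after any
finite time»). Not proved here. [cite: Kampen2015CKN, p. 4; Cor 1.8 p. 11] -/
def Step_bridgeB : Prop :=
  ClaimedTheorem → ClayVariants.clayPeriodic.Regularity

/-! ### Kernel relations -/

/-- Step 4 holds: termwise `|xy| ≤ (x² + y²)/2`, summed. [cite: Kampen2015CKN, (62)–(63) p. 13] -/
theorem step_4_holds : Step_4 := by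
  intro a b j k α s
  have key : ∀ γ ∈ s, |(γ j : ℝ) * ((α k : ℝ) - (γ k : ℝ)) * a γ * b (α - γ)| ≤
      (1 / 2) * (((γ j : ℝ)) ^ 2 * (a γ) ^ 2 + ((α k : ℝ) - (γ k : ℝ)) ^ 2 * (b (α - γ)) ^ 2) := by
    intro γ _
    set x : ℝ := (γ j : ℝ) * a γ with hx
    set y : ℝ := ((α k : ℝ) - (γ k : ℝ)) * b (α - γ) with hy
    have hxy : (γ j : ℝ) * ((α k : ℝ) - (γ k : ℝ)) * a γ * b (α - γ) = x * y := by
      rw [hx, hy]; ring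
    rw [hxy, show ((γ j : ℝ)) ^ 2 * (a γ) ^ 2 = x ^ 2 by rw [hx]; ring,
      show ((α k : ℝ) - (γ k : ℝ)) ^ 2 * (b (α - γ)) ^ 2 = y ^ 2 by rw [hy]; ring, abs_mul]
    nlinarith [sq_nonneg (|x| - |y|), sq_abs x, sq_abs y, abs_nonneg x, abs_nonneg y]
  calc |∑ γ ∈ s, (γ j : ℝ) * ((α k : ℝ) - (γ k : ℝ)) * a γ * b (α - γ)|
      ≤ ∑ γ ∈ s, |(γ j : ℝ) * ((α k : ℝ) - (γ k : ℝ)) * a γ * b (α - γ)| :=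
        Finset.abs_sum_le_sum_abs _ _
    _ ≤ ∑ γ ∈ s, (1 / 2) * (((γ j : ℝ)) ^ 2 * (a γ) ^ 2 +
          ((α k : ℝ) - (γ k : ℝ)) ^ 2 * (b (α - γ)) ^ 2) := Finset.sum_le_sum key
    _ = (1 / 2) * (∑ γ ∈ s, ((γ j : ℝ)) ^ 2 * (a γ) ^ 2 +
          ∑ γ ∈ s, ((α k : ℝ) - (γ k : ℝ)) ^ 2 * (b (α - γ)) ^ 2) := by
        rw [← Finset.mul_sum, Finset.sum_add_distrib]

/-- **KERNEL COMPOSITION.** Thm 1.2 (rendered) follows from the Steps by pure logic: an epoch of regularity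
before `t_s` (Step 0), the cone bounds (Steps 1–2), the transfer (Step 7). Steps 3–6 and `Lemma21` are the
printed support of the pressure input inside Step 7 (module docstring, COMPOSITION).
[cite: Kampen2015CKN, §2 pp. 12–16; Thm 1.2 p. 4] -/
theorem claim_of_steps (h0 : Step_0) (h1 : Step_1) (h2 : Step_2) (h7 : Step_7) : ClaimedTheorem := by
  intro ν hν T hT u₀ u hu ts hts
  obtain ⟨t₀, ht₀, w, hw⟩ := h0 ν hν T hT u₀ u hu ts hts
  exact h7 ν hν T hT u₀ u hu ts hts t₀ ht₀ w hw
    (fun xs => ⟨h1 ν hν T hT u₀ u hu ts hts t₀ ht₀ w hw xs, h2 ν hν T hT u₀ u hu ts hts t₀ ht₀ w hw xs⟩)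


/-! ### `Step_bridgeB` discharged (APPEND-ONLY, cell `ns-claims` lit-4 g6, 2026-08-27)

The Clay bridge of this row — «Theorem 1.2 for every Leray–Hopf solution from a smooth datum ⇒ Clay (B)» — is
the datum-wise Serrin `L^∞` criterion on `𝕋³`, now a theorem of the tree
(`ClayVariants.clayPeriodic_regularityAt_iff_lerayHopf_boundedFromLeft`, file `ClayPeriodicLerayHopfBridge.lean`:
Hopf's existence theorem, Sather–Serrin weak–strong uniqueness on `𝕋³`, and the velocity blow-up alternative for
periodic classical solutions); `BoundedFromLeft` is exactly its hypothesis shape. -/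

/-- **`Step_bridgeB` HOLDS**: Theorem 1.2 as typed (every Leray–Hopf weak solution on `𝕋³ × [0,T)` is
essentially bounded from the left below every `t_s ∈ (0,T]`) implies Clay (B) at every viscosity.
[cite: FeffermanClay2006, (B) with (8) (10) (11) p. 2] [cite: Serrin1962, Thm (L^∞ case)] [cite: RobinsonRodrigoSadowskiCUP2016, Thm 6.10] -/
theorem step_bridgeB_holds : Step_bridgeB := by
  intro hC ν hν
  refine (ClayVariants.clayPeriodic_regularityAt_iff_lerayHopf_boundedFromLeft hν).2 ?_
  intro u₀ _ _ _ w hw T hT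
  exact hC ν hν T hT (fun y => u₀ (Torus.repr y)) w (hw T hT) T ⟨hT, le_rfl⟩

/-- `Step_bridgeB` — `_holds` alias of `step_bridgeB_holds` above under the fact's exact name (appended
2026-08-28, D-0026 bookkeeping: the proof term is the existing theorem of this file; no statement,
definition or attribute is edited; no new named fact; the ledger's debt table listed the fact
unproved). [cite: RobinsonRodrigoSadowskiCUP2016, Thm 6.10] -/
theorem _root_.Literature.Claims.NS.Kampen2015.Step_bridgeB_holds : Step_bridgeB :=
  _root_.Literature.Claims.NS.Kampen2015.step_bridgeB_holds

end Literature.Claims.NS.Kampen2015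

end
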